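import Summits.QuantumFields.YangMills.Theorems.BalabanUVNodesN11Thm2Ineq249AtRecord13CoPH
import Literature.MathematicalPhysics.QuantumFieldTheory.Balaban1983to89.B14FlowStep

/-!
# DAG node N11 — [III] THEOREM 2 AT THE ₁₃ OBJECTS ⇒ (2.49), ALONG THE COUPLING WINDOW: (2.46)'s located coupling inputs DISCHARGED from the
# β-window data of the run of record (asymptotic-freedom lower bound `b ≤ β_{j+1}(g_j)`, window `0 < g_j ≤ γ`, smallness `γ⁴ ≤ b`, `γ ≤ ½`, `R₁γ^{κ₀−6} ≤ 1`)

Cell `pub-ymgap`, YM-PLAN Track A (HUMAN RULING D-0062 ∕ D-0149), seat `pub-ymgap-dag-n11-w2` (g0), route `BalabanUVNodes`, key item K1⁷ `StabilityBAtRecordR13SepCoPH` =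
stmt-QuantumFields-20542 (helper, count-neutral).  Sequel of this seat's `BalabanUVNodesN11Thm2Ineq249AtRecord13CoPH` (file 1: Theorem 2's sentences (2.43)_j ∕ (2.44)_j READ
AT r11's (2.23)-data of record ⇒ (2.49) `B14Thm2.Ineq249` for `action23` of record, with (2.46)'s middle∕last members «for κ₀ ≥ 7 and g sufficiently small» as the
DISPLAYED coupling hypotheses `hsum`, `hsmall` — the cell's located step T11.F).  [III] = [Balaban1988Convergent], [I] = [Balaban1987RG1].

WHY THIS FILE.  The cell's Literature ALREADY derives (2.46)'s middle member from a POSITIVE lower bound on the β-terms along the flow: `B14FlowStep.sumIneq246_of_betaPos`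
((0.20) + `0 < g_k ≤ γ` + `b ≤ β_{j+1}(g_j)` + `γ⁴ ≤ b`, `γ ≤ ½` ⇒ `Σ_{j=1}^{n} g_j^{κ₀} < g_n^{κ₀−6}`, κ₀ ≥ 7).  At NODE 00's Stage-13 run of record the flow is
`flowOfRun (gOfRecord₁₃ F N θ.toStage13Params p)`, whose (0.20) holds by `ring` (`flowOfRun_satisfiesRG`) and whose β-terms ARE the increments `g_j^{−2} − g_{j+1}^{−2}`; its
couplings are `genSeq (betaOfRecord₁₃ …) p.g0`, so the window binder the K1⁷ skeleton's (UV₁₃) row carries — `(genFlow (betaOfRecord₁₃ F N θ.toStage13Params) p.g0).InInterval w.γ P.K`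
— IS the window of `flowOfRun (gOfRecord₁₃ …)` (`Iff.rfl`).  Hence along the window, with the DAG's unprinted leaf `betaPositive` in its located quantitative form
`b ≤ g_j^{−2} − g_{j+1}^{−2}` (what K1⁷ rung 2's `BetaBoundsInInterval … b βup` delivers run by run through `DagBinding.alongRun_of_inInterval` and (0.20)), file 1's
`hsum`∕`hsmall` and the sign binder `hβj` of its constant-coupling half are THEOREMS: (2.49) at the record costs exactly Theorem 2's two sentences, (2.48), the vacuum
sentence, the β-window letters and `φ_j ≤ 1`.

WHAT THIS FILE PROVES (0 `sorry`, 0 `def`, standard axioms; count-neutral; nothing of Bałaban's asserted).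
`inInterval_genFlow_iff_flowOfRun₁₃` (the two window letters agree, `Iff.rfl`) · `sum246_inputs_at_record₁₃_of_window` (`hsum` ∧ `hsmall` of file 1 at the run of record from
`b`, `γ`, the window and the smallness letters; kernel = `B14FlowStep.sumIneq246_of_betaPos`) · `beta_nonneg_at_record₁₃_of_lower` (`0 ≤ g_{j−1}^{−2} − g_j^{−2}` from `0 < b ≤ …`) ·
★★ `ineq249_action23_at_record₁₃CoPH_of_thm2_of_window` ((2.49) for the (2.23)-action of record from Theorem 2's sentences + (2.48) + vacuum sentence ALONG THE WINDOW) ·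
★ `action23_at_record₁₃CoPH_le_of_thm2_of_window` (its constant-coupling upper half, adding only `φ_j ≤ 1`).

HONEST FRAMING.  Bookkeeping joining two tree theorems (file 1 and `B14FlowStep.sumIneq246_of_betaPos`) at the objects of record; the hypotheses (2.43)_j ∕ (2.44)_j ARE
[III] Thm 2 (proof = [III] §3, nobody's theorem in the tree), the β lower bound is the DAG's UNPRINTED leaf `betaPositive` (T09.F; [I] p. 264 defers «other properties» of β),
the smallness letters are print's «g sufficiently small».  N11 NOT discharged; K1⁷ NOT closed; counts unmoved (typed 28∕28 · discharged 5∕27).  One finite four-torus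
programme at fixed `ε = L^{−K}`; R4 closes only the conditional finite-𝕋⁴ rung `BalabanLadder.UV`; NOT ℝ⁴, NOT OS, NOT a mass gap, NOT Clay.
Sources: [III] (2.46) p. 263, (2.49) p. 264, (2.24) p. 259, Thm 2 p. 263; [I] (0.20) p. 256, p. 264.
-/

noncomputable section

open scoped BigOperators Matrix.Norms.L2Operator

namespace Summit.QuantumFields.YangMills.Theorems.BalabanUVNodesN11Thm2Ineq249AtRecord13CoPHWindow

open Literature.MathematicalPhysics.QuantumFieldTheory.Balaban1983to89 Step B14.Eq225Concrete B14.LocalCoupling B14Thm2 Finset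
open T4Continuum Node00
open FlowStepRuns (genFlow)
open BalabanUVNodesN11Thm2Ineq249AtRecord13CoPH (ineq249_action23_at_record₁₃CoPH_of_thm2 action23_at_record₁₃CoPH_le_of_thm2)

variable {F : T4Family} {N : ℕ} [NeZero N]
variable (θ : Stage13HParams F N) (p : B12.RunParams)

/-- **The two window letters agree**: the (UV₁₃) row's `(genFlow (betaOfRecord₁₃ …) p.g0).InInterval γ K′` IS the window of the §2 setting's flow
`flowOfRun (gOfRecord₁₃ …)` (both read the generated couplings `genSeq (betaOfRecord₁₃ …) p.g0`). [cite: Balaban1987RG1, (0.17)–(0.20) pp.255–256 (bookkeeping)] -/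
theorem inInterval_genFlow_iff_flowOfRun₁₃ (γ : ℝ) (K' : ℕ) :
    (genFlow (betaOfRecord₁₃ F N θ.toStage13Params) p.g0).InInterval γ K' ↔ (flowOfRun (gOfRecord₁₃ F N θ.toStage13Params p)).InInterval γ K' :=
  Iff.rfl

/-- **(2.46)'s located coupling inputs AT THE RUN OF RECORD, from the β-window letters** — «for κ₀ ≥ 7 and g sufficiently small»: (0.20) for `flowOfRun` (free), the window
`0 < g_j ≤ γ` (j ≤ K), the asymptotic-freedom lower bound `b ≤ g_j^{−2} − g_{j+1}^{−2}` (j < K; `b > 0`), `γ⁴ ≤ b`, `γ ≤ ½` and `R₁γ^{κ₀−6} ≤ 1` give, for every `k ≤ K`, file 1's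
`hsum` (`Σ_{j=1}^{n} g_j^{κ₀} ≤ g_n^{κ₀−6}`, 1 ≤ n ≤ k) and `hsmall` (`R₁ g_n^{κ₀−6} ≤ 1`).  Kernel = `B14FlowStep.sumIneq246_of_betaPos`.
[cite: Balaban1988Convergent, (2.46) p.263; Balaban1987RG1, (0.20) p.256] -/
theorem sum246_inputs_at_record₁₃_of_window {γ b R₁ : ℝ} {κ₀ K' k : ℕ} (hκ : 7 ≤ κ₀) (hb : 0 < b) (hγ4 : γ ^ 4 ≤ b) (hγ2 : γ ≤ 1 / 2)
    (hR : 0 ≤ R₁) (hRγ : R₁ * γ ^ (κ₀ - 6) ≤ 1)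
    (hI : (genFlow (betaOfRecord₁₃ F N θ.toStage13Params) p.g0).InInterval γ K')
    (hlb : ∀ j, j < K' → b ≤ 1 / gOfRecord₁₃ F N θ.toStage13Params p j ^ 2 - 1 / gOfRecord₁₃ F N θ.toStage13Params p (j + 1) ^ 2) (hk : k ≤ K') :
    (∀ n, 1 ≤ n → n ≤ k → ∑ j ∈ Icc 1 n, (gOfRecord₁₃ F N θ.toStage13Params p j) ^ κ₀ ≤ (gOfRecord₁₃ F N θ.toStage13Params p n) ^ (κ₀ - 6)) ∧
      (∀ n, 1 ≤ n → n ≤ k → R₁ * (gOfRecord₁₃ F N θ.toStage13Params p n) ^ (κ₀ - 6) ≤ 1) := by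
  have h246 := B14FlowStep.sumIneq246_of_betaPos (flowOfRun (gOfRecord₁₃ F N θ.toStage13Params p)) K' hb hγ4 hγ2
    (flowOfRun_satisfiesRG (gOfRecord₁₃ F N θ.toStage13Params p) K') hI hlb hκ
  refine ⟨fun n _ hn => (h246 n (hn.trans hk)).le, fun n _ hn => ?_⟩
  have hg := hI n (hn.trans hk)
  have hγ : 0 ≤ γ := hg.1.le.trans hg.2
  calc R₁ * (gOfRecord₁₃ F N θ.toStage13Params p n) ^ (κ₀ - 6) ≤ R₁ * γ ^ (κ₀ - 6) :=
        mul_le_mul_of_nonneg_left (pow_le_pow_left₀ hg.1.le hg.2 _) hR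
    _ ≤ 1 := hRγ

/-- `0 ≤ β_j(g_{j−1}) = g_{j−1}^{−2} − g_j^{−2}` for `1 ≤ j ≤ k ≤ K` from the positive lower bound. [cite: Balaban1987RG1, (0.20) p.256 (bookkeeping)] -/
theorem beta_nonneg_at_record₁₃_of_lower {b : ℝ} {K' k : ℕ} (hb : 0 < b)
    (hlb : ∀ j, j < K' → b ≤ 1 / gOfRecord₁₃ F N θ.toStage13Params p j ^ 2 - 1 / gOfRecord₁₃ F N θ.toStage13Params p (j + 1) ^ 2) (hk : k ≤ K') :
    ∀ j, 1 ≤ j → j ≤ k → 0 ≤ 1 / gOfRecord₁₃ F N θ.toStage13Params p (j - 1) ^ 2 - 1 / gOfRecord₁₃ F N θ.toStage13Params p j ^ 2 := by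
  intro j hj hjk
  have h := hlb (j - 1) (by omega)
  rw [Nat.sub_add_cancel hj] at h
  exact hb.le.trans h

/-- **★★ (2.49) FOR THE (2.23)-ACTION OF RECORD FROM THEOREM 2's SENTENCES, ALONG THE COUPLING WINDOW** (v1.7 `CoPH`): file 1's ★★ `ineq249_action23_at_record₁₃CoPH_of_thm2`
with (2.46)'s located inputs DISCHARGED by `sum246_inputs_at_record₁₃_of_window` — hypotheses left: [III] Thm 2's (2.43)_j ∕ (2.44)_j at the summands of record, (2.48) on
`B240`, the vacuum sentence (`hEk`, `hvac`), the window `(genFlow (betaOfRecord₁₃ …) p.g0).InInterval γ K′` (the (UV₁₃) row's letter), `b ≤ g_j^{−2} − g_{j+1}^{−2}` (j < K′),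
`γ⁴ ≤ b`, `γ ≤ ½`, `R₁γ^{κ₀−6} ≤ 1`, `k ≤ K′`. [cite: Balaban1988Convergent, Thm 2 (2.43)–(2.44) p.263, (2.45)–(2.49) pp.263–264; Balaban1987RG1, (0.20) p.256] -/
theorem ineq249_action23_at_record₁₃CoPH_of_thm2_of_window {k : ℕ} (s : SeqOfRecord F θ.ν θ.τ9.M (gOfRecord₁₃ F N θ.toStage13Params p) p.K k)
    (t : Sect2.TermValues (F.P p.K) (MatA N) (FluctV N) θ.τ9.M) (a : Tk.SFluct (F.P p.K) (FluctV N)) (κ₀ : ℕ) (hκ : 7 ≤ κ₀)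
    (Ek EkLog EkRest : ℝ) (hEk : Ek = EkLog + EkRest) (U : GaugeField (F.P p.K) 0 (SU N)) (E₁ R₁ B₁ L β E₂ : ℝ) (Γ : ℕ → ℝ)
    (hL : 1 < L) (hβ : 0 < β) (hE : 0 ≤ E₁) (hR : 0 ≤ R₁) (hΓ : ∀ n, 1 ≤ n → n ≤ k → 0 ≤ Γ n)
    {γ b : ℝ} {K' : ℕ} (hb : 0 < b) (hγ4 : γ ^ 4 ≤ b) (hγ2 : γ ≤ 1 / 2) (hRγ : R₁ * γ ^ (κ₀ - 6) ≤ 1)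
    (hI : (genFlow (betaOfRecord₁₃ F N θ.toStage13Params) p.g0).InInterval γ K')
    (hlb : ∀ j, j < K' → b ≤ 1 / gOfRecord₁₃ F N θ.toStage13Params p j ^ 2 - 1 / gOfRecord₁₃ F N θ.toStage13Params p (j + 1) ^ 2) (hk : k ≤ K')
    (h243 : ∀ j, 1 ≤ j → j ≤ k →
      |EjSub (sect2TowerOfRecord F N (FluctV N) p.K (settingOfRecord₁₃ F N θ.toStage13Params p) (θ.rzAt p s) s t)
            (fun j X z => Sect2.admE (F.P p.K) θ.ν θ.τ9.M (gOfRecord₁₃ F N θ.toStage13Params p) s.Λ j (Sect2.domSites (F.P p.K) θ.τ9.M j X) z) j U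
          - (1 / gOfRecord₁₃ F N θ.toStage13Params p (j - 1) ^ 2 - 1 / gOfRecord₁₃ F N θ.toStage13Params p j ^ 2) *
              smearedWilson (θ.Phih p k s.Ω s.Λ j) U| ≤ E₁ * ∑ n ∈ Icc j k, (L ^ ((j : ℝ) - n)) ^ β * Γ n)
    (h244 : ∀ j, 1 ≤ j → j ≤ k →
      |∑ X : (Sect2.domSys (F.P p.K) θ.τ9.M j).Dom, (if Sect2.admR (F.P p.K) θ.ν θ.τ9.M (gOfRecord₁₃ F N θ.toStage13Params p) s.Λ j (Sect2.domSites (F.P p.K) θ.τ9.M j X) then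
          ((t.R j X (Sect2.ofBackgroundC (ιSU N) U)).re - (t.R j X (Sect2.ofBackgroundC (ιSU N) 1)).re) else 0)| ≤
        R₁ * (gOfRecord₁₃ F N θ.toStage13Params p j) ^ κ₀ * ∑ n ∈ Icc j k, Γ n)
    (h248 : |B240 (sect2TowerOfRecord F N (FluctV N) p.K (settingOfRecord₁₃ F N θ.toStage13Params p) (θ.rzAt p s) s t)
        (fun j X => Sect2.admB (F.P p.K) θ.ν θ.τ9.M (gOfRecord₁₃ F N θ.toStage13Params p) s.Ω s.Λ j (Sect2.domSites (F.P p.K) θ.τ9.M j X)) a k U| ≤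
      2 * B₁ * ∑ n ∈ Icc 1 k, Γ n)
    (hvac : VacuumRestBound EkRest E₂ Γ k) :
    Ineq249 ((sect2ActionDataOfRecord F N (FluctV N) p.K (settingOfRecord₁₃ F N θ.toStage13Params p) (θ.rzAt p s) s t a Ek).action23 k U)
      (smearedWilson (invSq (flowOfRun (gOfRecord₁₃ F N θ.toStage13Params p)) (θ.Phih p k s.Ω s.Λ) k) U) (-EkLog)
      (E₁ * (1 - L ^ (-β))⁻¹ + 1 + 2 * B₁ + E₂) Γ k := by
  obtain ⟨hsum, hsmall⟩ := sum246_inputs_at_record₁₃_of_window θ p hκ hb hγ4 hγ2 hR hRγ hI hlb hk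
  exact ineq249_action23_at_record₁₃CoPH_of_thm2 θ p s t a κ₀ hκ Ek EkLog EkRest hEk U E₁ R₁ B₁ L β E₂ Γ hL hβ hE hR hΓ h243 h244 hsum hsmall h248 hvac

/-- **★ The upper half in constant-coupling currency, along the window** (`g_k = gOfRecord₁₃ … p k`): adds only `φ_j ≤ 1` (the history's cut-offs); the sign `β_j ≥ 0` comes from
`b > 0`.  `A_k(s)(U) ≤ −(1∕g_k²)·A(U) − EkLog + (E₁(1−L^{−β})⁻¹ + 1 + 2B₁ + E₂)·Σ_{n=1}^{k} Γ_n` — the half the UPPER bound of (2.50) consumes.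
[cite: Balaban1988Convergent, (2.49)–(2.50) p.264, (2.24) p.259, (2.46) p.263] -/
theorem action23_at_record₁₃CoPH_le_of_thm2_of_window {k : ℕ} (s : SeqOfRecord F θ.ν θ.τ9.M (gOfRecord₁₃ F N θ.toStage13Params p) p.K k)
    (t : Sect2.TermValues (F.P p.K) (MatA N) (FluctV N) θ.τ9.M) (a : Tk.SFluct (F.P p.K) (FluctV N)) (κ₀ : ℕ) (hκ : 7 ≤ κ₀)
    (Ek EkLog EkRest : ℝ) (hEk : Ek = EkLog + EkRest) (U : GaugeField (F.P p.K) 0 (SU N)) (E₁ R₁ B₁ L β E₂ : ℝ) (Γ : ℕ → ℝ)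
    (hL : 1 < L) (hβ : 0 < β) (hE : 0 ≤ E₁) (hR : 0 ≤ R₁) (hΓ : ∀ n, 1 ≤ n → n ≤ k → 0 ≤ Γ n)
    {γ b : ℝ} {K' : ℕ} (hb : 0 < b) (hγ4 : γ ^ 4 ≤ b) (hγ2 : γ ≤ 1 / 2) (hRγ : R₁ * γ ^ (κ₀ - 6) ≤ 1)
    (hI : (genFlow (betaOfRecord₁₃ F N θ.toStage13Params) p.g0).InInterval γ K')
    (hlb : ∀ j, j < K' → b ≤ 1 / gOfRecord₁₃ F N θ.toStage13Params p j ^ 2 - 1 / gOfRecord₁₃ F N θ.toStage13Params p (j + 1) ^ 2) (hk : k ≤ K')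
    (hφ : ∀ j, 1 ≤ j → j ≤ k → ∀ x, θ.Phih p k s.Ω s.Λ j x ≤ 1)
    (h243 : ∀ j, 1 ≤ j → j ≤ k →
      |EjSub (sect2TowerOfRecord F N (FluctV N) p.K (settingOfRecord₁₃ F N θ.toStage13Params p) (θ.rzAt p s) s t)
            (fun j X z => Sect2.admE (F.P p.K) θ.ν θ.τ9.M (gOfRecord₁₃ F N θ.toStage13Params p) s.Λ j (Sect2.domSites (F.P p.K) θ.τ9.M j X) z) j U
          - (1 / gOfRecord₁₃ F N θ.toStage13Params p (j - 1) ^ 2 - 1 / gOfRecord₁₃ F N θ.toStage13Params p j ^ 2) *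
              smearedWilson (θ.Phih p k s.Ω s.Λ j) U| ≤ E₁ * ∑ n ∈ Icc j k, (L ^ ((j : ℝ) - n)) ^ β * Γ n)
    (h244 : ∀ j, 1 ≤ j → j ≤ k →
      |∑ X : (Sect2.domSys (F.P p.K) θ.τ9.M j).Dom, (if Sect2.admR (F.P p.K) θ.ν θ.τ9.M (gOfRecord₁₃ F N θ.toStage13Params p) s.Λ j (Sect2.domSites (F.P p.K) θ.τ9.M j X) then
          ((t.R j X (Sect2.ofBackgroundC (ιSU N) U)).re - (t.R j X (Sect2.ofBackgroundC (ιSU N) 1)).re) else 0)| ≤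
        R₁ * (gOfRecord₁₃ F N θ.toStage13Params p j) ^ κ₀ * ∑ n ∈ Icc j k, Γ n)
    (h248 : |B240 (sect2TowerOfRecord F N (FluctV N) p.K (settingOfRecord₁₃ F N θ.toStage13Params p) (θ.rzAt p s) s t)
        (fun j X => Sect2.admB (F.P p.K) θ.ν θ.τ9.M (gOfRecord₁₃ F N θ.toStage13Params p) s.Ω s.Λ j (Sect2.domSites (F.P p.K) θ.τ9.M j X)) a k U| ≤
      2 * B₁ * ∑ n ∈ Icc 1 k, Γ n)
    (hvac : VacuumRestBound EkRest E₂ Γ k) :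
    (sect2ActionDataOfRecord F N (FluctV N) p.K (settingOfRecord₁₃ F N θ.toStage13Params p) (θ.rzAt p s) s t a Ek).action23 k U ≤
      -(1 / (gOfRecord₁₃ F N θ.toStage13Params p k) ^ 2 * wilsonAction4 U) - EkLog + (E₁ * (1 - L ^ (-β))⁻¹ + 1 + 2 * B₁ + E₂) * ∑ n ∈ Icc 1 k, Γ n := by
  obtain ⟨hsum, hsmall⟩ := sum246_inputs_at_record₁₃_of_window θ p hκ hb hγ4 hγ2 hR hRγ hI hlb hk
  exact action23_at_record₁₃CoPH_le_of_thm2 θ p s t a κ₀ hκ Ek EkLog EkRest hEk U E₁ R₁ B₁ L β E₂ Γ hL hβ hE hR hΓ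
    (beta_nonneg_at_record₁₃_of_lower θ p hb hlb hk) hφ h243 h244 hsum hsmall h248 hvac

end Summit.QuantumFields.YangMills.Theorems.BalabanUVNodesN11Thm2Ineq249AtRecord13CoPHWindow

end
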